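import Literature.MathematicalPhysics.QuantumFieldTheory.Balaban1983to89.B5QGGQ145Factor
import Literature.MathematicalPhysics.QuantumFieldTheory.Balaban1983to89.B4StripSumsDeriv
import Literature.MathematicalPhysics.QuantumFieldTheory.Balaban1983to89.B4Sect5Torus

/-!
# Bałaban 1984 (Propagators & RT I), (1.126): the kernel of `∂P∂^*` decays exponentially with constants depending on
# `d` only — the `k`-UNIFORM, VOLUME-UNIFORM statement, certified in the `U = 1` torus multiplier model

CITATION HEADER.  T. Bałaban, *Propagators and renormalization transformations for lattice gauge theories. I*,
Commun. Math. Phys. **95** (1984) 17–40 (`Balaban1984PropagatorsI`, B5), §E pp. 37–38; T. Bałaban, *Regularity and decay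
of lattice Green's functions*, Commun. Math. Phys. **89** (1983) 571–597 (`Balaban1983RegularityDecay`, B4), Lemma 2.4
(2.35) p. 582 with (2.47)–(2.51) pp. 585–586.  This file is a SUPPLEMENT written by the audit, NOT a quotation: B5 states
(1.126) and says only where it comes from; no proof is printed.  Journal page = PDF page + 16 for B5.

THE PRINTED TEXT (B5 p. 38, verbatim from the page image): «Let us write bounds for the operator ∂P∂*. They follow from
the representation P = G′Q′*(Q′G′²Q′*)⁻¹Q′G′, from Lemma 2.4 of [2], and the representation (1.45) and the analyticity
method of proving an exponential decay (see the proof of Lemma 2.4 in [2]). We obtain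
  |(∂P∂*)_{μ,ν}(x, x′)| ≦ O(1)e^{−δ′₀|x−x′|},   (1.126)»
and, after (1.127): «The constant O(1) in (1.126) depends on d only, and in (1.127) it depends on α also».  The kernel
convention is (1.120), p. 37: «(∂P∂*hA)_μ(x) = Σ_{x′,ν} η^d(∂P∂*)_{μν}(x, x′)h(x′)A_ν(x′)» — the kernel is taken with
respect to the `η`-WEIGHTED measure `η^d Σ_{x′ ∈ T_η}`.  The operators: p. 25 «let us denote Δ′_a = Δ + aQ′_k*Q′_k =
Δ + aP′_k. The properties of this operator were investigated in [2], its inverse is a bounded operator G′_k»; `∂` is the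
difference derivative of B4 p. 573 «(∂^η_μA)(x) = η^{−1}(A(x+ηe_μ) − A(x))».

WHAT THE CELL ALREADY HAS.  In the `U = 1`, `m² = 0` torus multiplier model fixed by `B5QGGQ145Torus`/`Bounds`/`Factor`
(b05-g7; dimension written `d+1`, `n = L^k = η⁻¹` fine points per unit block, period vector `N`, fine torus
`Π_μ Fin (nN_μ)`, unit torus `Π_μ Fin N_μ`, `a ∈ [a₋,a₊]`, `0 < a₋`): `KRe` = the counting-measure matrix of `G′_kQ′_k^*`
(entries `Re K_T(z,y)`, `K_T` = b04's `B4TorusGreen244.KT` at `m² = 0`), `QGRe = η^{d+1}·KReᵀ` = the matrix of `Q′_kG′_k`,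
`qggqRe = QGRe·KRe` = `Q′_kG′_k²Q′_k^*`, `kerRe = qggqRe⁻¹` (`B5QGGQ145Bounds.qggqRe_inv`, pv17's (1.45)-multiplier
`torusKernel145M`), so that the counting-measure matrix of `P = G′Q′*(Q′G′²Q′*)⁻¹Q′G′` is `KRe·kerRe·QGRe`; and the
UNIFORM entry decay of `KRe` (`B5QGGQ145Factor.KRe_decay`, from B4 Lemma 2.4 on the torus) and of `kerRe`
(`B5Torus145Decay.inverse145_torusKernelM_decay_torusMetric`), both with constants depending on `d, a₋, a₊` only and
rates measured in the COARSE (unit-lattice) torus distance.  The cell's abstract (1.126)-engine (`B5Decay126` and the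
leaves built on it) works on the FINE carrier `Π_μ Fin (nN_μ)` with constants that are allowed to depend on `n`; it does
not give the uniformity recorded here.

THIS FILE supplies the uniform statement.  The only new analytic input is b04's torus `∂`-kernel: §1 proves the symbol
identity `n·(Gfull(z+e_μ; p′) − Gfull(z; p′)) = e^{ip′·⌊z/n⌋}·GD_{z mod n, μ}(p′)` (`B4Green244.PhZ_add_e`,
`PhZ_finePt`; `GD` = `B4StripSumsDeriv.GD`, the multiplier of `∂^ξ_μ G_jQ_j^*`) and hence
`n·(K_T(z+e_μ, y) − K_T(z, y)) = torusKernelD248 n a m² (z mod n) μ N (⌊z/n⌋ − y)` (`KT_fdiff`): the forward `η⁻¹`-difference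
of the factor `G′Q′^*` in the fine variable IS b04's differentiated torus kernel, which decays UNIFORMLY in `n`, the offset,
the direction and the volume (`B4StripSumsDeriv.dkernel248_torusKernel_decay_torusMetric`).  §2 packages it as the real
matrix `DKRe μ` (fine × coarse) and records the two factor bounds.  §3 defines
  `dpd n a N μ ν := DKRe μ · kerRe · (DKRe ν)ᵀ`  (fine × fine, composed over the COARSE torus only)
and §6 proves it is `η^{−(d+1)}` times the counting-measure matrix `Dmat μ · (KRe·kerRe·QGRe) · (Dmat ν)ᵀ` of
`∂_μ P ∂_ν^*` (`Dmat μ` = the matrix of `η⁻¹`(forward difference) on the fine torus, `∂^*` = transpose for the common weight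
`η^{d+1}`), i.e. `dpd` IS the `η`-weighted kernel `(∂P∂*)_{μν}(x,x′)` of (1.120).  §4 is the torus convolution estimate
`Σ_y e^{−αt(x,y)} e^{−αt(y,y′)} ≤ K_{d+1}(α/2) e^{−(α/2)t(x,y′)}` uniformly in the period (`B4Sect5Torus.torusSum_le`), and
§5 the HEADLINE `dpd_decay_uniform`: there are `δ > 0`, `C ≥ 0` depending on `d, a₋, a₊` ONLY such that for every
`n = L^k ≥ 1`, `a ∈ [a₋,a₊]`, every period vector (`N_μ ≥ 1`), all `μ, ν, x, x′`,
  `|dpd n a N μ ν x x′| ≤ C · e^{−δ·|⌊x/n⌋ − ⌊x′/n⌋|_{T₁}}`,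
together with the printed form `≤ C′ · e^{−(δ/n)·tdist_{T_η}(x,x′)}` (`dpd_decay_uniform_fine`; the `|x − x′|` of (1.126) is
`η`·(number of fine steps)) and the counting-measure form (`matrixP_decay_uniform`).  This is the content of «The constant
O(1) in (1.126) depends on d only» in the model: the constants do not see `k` (through `n = L^k`) nor the volume.

WHY THE COMPOSITION IS OVER THE COARSE TORUS (the mechanism replacing the printed "analyticity method").  All three factors
of `∂_μ G′Q′^* · (Q′G′²Q′^*)⁻¹ · (∂_ν G′Q′^*)^T` are kernels with one or both indices on the UNIT torus and decay at an
`n`-independent rate in the unit-lattice distance; the two matrix products sum over unit-torus points only, so the lattice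
sums cost `K_{d+1}(α/2)·K_{d+1}(α/4)` — independent of `n` and of the period — and no power of `η` is lost or gained
(the `η^{d+1}` of `Q′G′ = η^{d+1}(G′Q′^*)ᵀ` is exactly the weight converting the counting-measure matrix into the
`η`-weighted kernel).  The printed route (analytic continuation of the three multipliers in `p′` and a contour shift) would
give the same statement; the audit's route uses the already-landed torus decay of each factor instead.

HONEST SCOPE.  Covered: (1.126) for `U = 1`, `m² = 0`, on the torus, `η`-weighted kernel, sup-metric, every `k ≥ 0` and
every volume, constants `d, a₋, a₊` only (the paper eventually takes `a = 1`, p. 25).  NOT covered: the Hölder estimate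
(1.127); external gauge fields `U ≠ 1` (no Fourier analysis); the `ℓ²`/operator-norm forms; (1.128) (pv15's leaves).  The
relation to the engine leaves' un-normalised forward differences is `η`-bookkeeping only (`Dmat` carries the factor
`η⁻¹ = n`); nothing of them is imported here.  Value = kernel certificate of a printed by-reference claim in an
explicit model — NOT summit progress.

TAGS: `[cite: Balaban1984PropagatorsI, …]` on the decls that formalise a printed display/sentence ((1.120), (1.126),
p. 38 ll. 7–10), `[cite: Balaban1983RegularityDecay, …]` on the B4 Lemma 2.4 inputs, `[folklore]` on index bookkeeping and
the elementary convolution estimate.  This module imports `B5QGGQ145Factor` (b05-g7), `B4StripSumsDeriv` (b04) and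
`B4Sect5Torus` (pv23) only.
-/

namespace Literature.MathematicalPhysics.QuantumFieldTheory.Balaban1983to89.B5DPD126Uniform

open Complex Finset UnitAddTorus
open Literature.MathematicalPhysics.QuantumFieldTheory.Balaban1983to89.B4Strip
open Literature.MathematicalPhysics.QuantumFieldTheory.Balaban1983to89.B4ContourShift
open Literature.MathematicalPhysics.QuantumFieldTheory.Balaban1983to89.B4StripSums
open Literature.MathematicalPhysics.QuantumFieldTheory.Balaban1983to89.B4StripSumsHolder
open Literature.MathematicalPhysics.QuantumFieldTheory.Balaban1983to89.B4StripSumsDeriv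
open Literature.MathematicalPhysics.QuantumFieldTheory.Balaban1983to89.B4TorusKernel
open Literature.MathematicalPhysics.QuantumFieldTheory.Balaban1983to89.B4Torus248Decay
open Literature.MathematicalPhysics.QuantumFieldTheory.Balaban1983to89.B4Green244
open Literature.MathematicalPhysics.QuantumFieldTheory.Balaban1983to89.B4TorusGreen244
open Literature.MathematicalPhysics.QuantumFieldTheory.Balaban1983to89.B4Sect5Torus
open Literature.MathematicalPhysics.QuantumFieldTheory.Balaban1983to89.B5Torus145Decay
open Literature.MathematicalPhysics.QuantumFieldTheory.Balaban1983to89.B5QGGQ145Torus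
open Literature.MathematicalPhysics.QuantumFieldTheory.Balaban1983to89.B5QGGQ145Bounds
open Literature.MathematicalPhysics.QuantumFieldTheory.Balaban1983to89.B5QGGQ145Factor
open scoped Real Matrix

noncomputable section

variable {d : ℕ}

/-! ### §1 The symbol identity for the forward difference of `G′Q′^*` in the fine variable -/

/-- **FORWARD DIFFERENCE OF THE FULL MULTIPLIER**: `n·(Gfull(z + e_μ; p′) − Gfull(z; p′)) = e^{ip′·⌊z/n⌋}·GD_{z mod n, μ}(p′)`
— the `η⁻¹`-difference quotient (B4 p. 573) of `z ↦ Gfull(z; p′) = Σ_k e^{i(p′+2πk)·z/n} V R/E` multiplies the `k`-th term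
by `n(e^{i(p′_μ+2πk_μ)/n} − 1) = D`, i.e. produces b04's differentiated multiplier `GD` at the offset of `z`.
[cite: Balaban1983RegularityDecay, (2.48)–(2.49) p.585 with p.573 (difference derivative); proof supplied by the audit] -/
theorem Gfull_fdiff (n : ℕ) [NeZero n] (a m2 : ℝ) (z : Fin (d + 1) → ℤ) (μ : Fin (d + 1)) (P : Fin (d + 1) → ℂ) :
    (n : ℂ) * (Gfull n a m2 (z + e μ) P - Gfull n a m2 z P)
      = cexp (I * phaseC P (coarse n z)) * GD n a m2 (offset n z) μ P := by
  have hPh : ∀ k : Fin (d + 1) → Fin n,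
      PhZ n k z P = cexp (I * phaseC P (coarse n z)) * ∏ ν, ef n (k ν : ℕ) ((offset n z ν : ℕ)) (P ν) := by
    intro k
    conv_lhs => rw [← finePt_coarse_offset n z]
    exact PhZ_finePt n (NeZero.ne n) k (coarse n z) (offset n z) P
  unfold Gfull GD termD D term F V
  rw [← Finset.sum_sub_distrib, Finset.mul_sum, Finset.mul_sum]
  refine Finset.sum_congr rfl fun k _ => ?_
  have hexp : cexp (I * ((P μ + 2 * π * ((k μ : ℕ) : ℂ)) / n)) = cexp (I * (P μ + 2 * π * ((k μ : ℕ) : ℂ)) / n) := by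
    congr 1; ring
  rw [PhZ_add_e, hPh k, Finset.prod_mul_distrib, hexp]
  ring

/-- **THE FORWARD `η⁻¹`-DIFFERENCE OF `K_T = G′Q′^*δ_y` IN THE FINE POINT IS b04's DIFFERENTIATED TORUS KERNEL**:
`n·(K_T(z + e_μ, y) − K_T(z, y)) = torusKernelD248 n a m² (z mod n) μ N (⌊z/n⌋ − y)` — on the torus, `∂^η_μ` applied to the
first variable of the kernel of `G′_kQ′_k^*` gives the kernel of `∂^η_μ G′_kQ′_k^*` of B4 Lemma 2.4 (second quantity of (2.35)).
[cite: Balaban1983RegularityDecay, Lemma 2.4 (2.35) p.582 (second quantity) with (2.48)–(2.49) p.585 and p.572 (torus);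
Balaban1984PropagatorsI p.38 ll.7–10 (before (1.126)); proof supplied by the audit] -/
theorem KT_fdiff (n : ℕ) [NeZero n] (a m2 : ℝ) (N : Fin (d + 1) → ℕ) (z y : Fin (d + 1) → ℤ) (μ : Fin (d + 1)) :
    (n : ℂ) * (KT n a m2 N (z + e μ) y - KT n a m2 N z y)
      = torusKernelD248 n a m2 (offset n z) μ N (coarse n z - y) := by
  rw [KT_eq_sum, KT_eq_sum, ← Finset.sum_sub_distrib, Finset.mul_sum]
  unfold torusKernelD248
  rw [Finset.mul_sum]
  refine Finset.sum_congr rfl fun k _ => ?_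
  have hG := Gfull_fdiff n a m2 z μ (ofRealVec (dualMomentum N k))
  have hdm : (fun i => 2 * π * rep (MultiPeriod.gridPt N k i)) = dualMomentum N k := rfl
  rw [← mul_sub, mul_left_comm, hG, hdm, mFourier_gridPt, phaseC_sub, mul_sub, Complex.exp_sub, Complex.exp_neg]
  rw [div_eq_mul_inv]
  ring

/-! ### §2 The factor `∂_μ G′_kQ′_k^*` as a real matrix (fine index × coarse index) and the two factor bounds -/

/-- **THE FACTOR `∂^η_μ(G′_kQ′_k^*)` AS A REAL MATRIX**: rows = the fine torus `Π_μ Fin (nN_μ)`, columns = the unit torus;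
entry `n·(Re K_T(z + e_μ, k) − Re K_T(z, k))` — the forward `η⁻¹`-difference quotient in the fine (row) variable of the
matrix `KRe` of `G′Q′^*` (`DKRe_eq_fdiff`: the shift `z + e_μ` may be taken in `ℤ^{d+1}`, `K_T(·,k)` being
`(nN_μ)_μ`-periodic). [cite: Balaban1984PropagatorsI, p.38 ll.7–10 (before (1.126)) (the factor `∂G′Q′^*` of `∂P∂^*`,
`P = G′Q′*(Q′G′²Q′*)⁻¹Q′G′`); Balaban1983RegularityDecay p.573 (difference derivative)] -/
def DKRe (n : ℕ) [NeZero n] (a : ℝ) (N : Fin (d + 1) → ℕ) (μ : Fin (d + 1)) :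
    Matrix (Idx (fun i => n * N i)) (Idx N) ℝ :=
  Matrix.of fun z k => (n : ℝ) * ((KT n a 0 N (toZ z + e μ) (toZ k)).re - (KT n a 0 N (toZ z) (toZ k)).re)

/-- the entry of `DKRe μ` IS (the real part of) b04's differentiated torus kernel at the offset and block of the row.
[folklore] -/
theorem DKRe_eq (n : ℕ) [NeZero n] (a : ℝ) (N : Fin (d + 1) → ℕ) (μ : Fin (d + 1))
    (z : Idx (fun i => n * N i)) (k : Idx N) :
    DKRe n a N μ z k = (torusKernelD248 n a 0 (offset n (toZ z)) μ N (coarse n (toZ z) - toZ k)).re := by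
  rw [← KT_fdiff n a 0 N (toZ z) (toZ k) μ]
  simp only [DKRe, Matrix.of_apply]
  rw [show (n : ℂ) = ((n : ℝ) : ℂ) from (Complex.ofReal_natCast n).symm, Complex.re_ofReal_mul, Complex.sub_re]

/-- **THE ENTRIES OF `∂_μ G′Q′^*` DECAY, UNIFORMLY IN `k`, THE OFFSET, THE DIRECTION AND THE VOLUME** — b04's
`dkernel248_torusKernel_decay_torusMetric` (B4 Lemma 2.4 (2.35), second quantity, on the torus) at `m² = 0` read on `DKRe`:
for `0 < a₋ ≤ a₊` there are `κ > 0`, `M ≥ 0` with `|DKRe_{n,a,N,μ}(z,k)| ≤ M·periodConst κ d·e^{−(κ/(d+1))·|⌊z/n⌋ − k|_{T₁}}`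
for every `n ≥ 1`, `a ∈ [a₋,a₊]`, `N` (`N_μ ≥ 1`), `μ`, `z`, `k`.
[cite: Balaban1983RegularityDecay, Lemma 2.4 (2.35) p.582 (second quantity); Balaban1984PropagatorsI p.38 "from Lemma 2.4
of [2]"] -/
theorem DKRe_decay (d : ℕ) (aminus aplus : ℝ) (ha : 0 < aminus) :
    ∃ κ M : ℝ, 0 < κ ∧ 0 ≤ M ∧ ∀ (n : ℕ) [NeZero n] (a : ℝ), aminus ≤ a → a ≤ aplus →
      ∀ (N : Fin (d + 1) → ℕ), (∀ i, 1 ≤ N i) → ∀ (μ : Fin (d + 1)) (z : Idx (fun i => n * N i)) (k : Idx N),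
        |DKRe n a N μ z k| ≤ M * periodConst κ d *
          Real.exp (-(κ / (d + 1) * MultiPeriod.torusSupNorm N (coarse n (toZ z) - toZ k))) := by
  obtain ⟨κ, M, hκ, hM, h⟩ := dkernel248_torusKernel_decay_torusMetric d aminus aplus 0 ha
  refine ⟨κ, M, hκ, hM, fun n _ a ha1 ha2 N hN μ z k => ?_⟩
  rw [DKRe_eq]
  exact (Complex.abs_re_le_norm _).trans
    (h n a 0 ha1 ha2 le_rfl le_rfl (offset n (toZ z)) μ N hN (coarse n (toZ z) - toZ k))

/-- **THE ENTRIES OF `(Q′G′²Q′^*)⁻¹` DECAY, UNIFORMLY** — pv17's `inverse145_torusKernelM_decay_torusMetric` read on the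
matrix `kerRe` (entry `Re torusKernel145M (k − k′)`). [cite: Balaban1984PropagatorsI, (1.45) p.26 with p.38 "the
representation (1.45) and the analyticity method"] -/
theorem kerRe_decay (d : ℕ) (aminus aplus : ℝ) (ha : 0 < aminus) :
    ∃ κ M : ℝ, 0 < κ ∧ 0 ≤ M ∧ ∀ (n : ℕ) [NeZero n] (a : ℝ), aminus ≤ a → a ≤ aplus →
      ∀ (N : Fin (d + 1) → ℕ), (∀ i, 1 ≤ N i) → ∀ (k k' : Idx N),
        |kerRe n a N k k'| ≤ M * periodConst κ d *
          Real.exp (-(κ / (d + 1) * MultiPeriod.torusSupNorm N (toZ k - toZ k'))) := by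
  obtain ⟨κ, c, hκ, hc, h⟩ := inverse145_torusKernelM_decay_torusMetric d aminus aplus ha
  refine ⟨κ, c⁻¹, hκ, inv_nonneg.mpr hc.le, fun n _ a ha1 ha2 N hN k k' => ?_⟩
  calc |kerRe n a N k k'| = |(torusKernel145M n a N (toZ k - toZ k')).re| := rfl
    _ ≤ ‖torusKernel145M n a N (toZ k - toZ k')‖ := Complex.abs_re_le_norm _
    _ ≤ c⁻¹ * periodConst κ d * Real.exp (-(κ / (d + 1) * MultiPeriod.torusSupNorm N (toZ k - toZ k'))) :=
        h n a ha1 ha2 N hN (toZ k - toZ k')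

/-! ### §3 The `η`-weighted kernel of `∂_μ P ∂_ν^*` -/

/-- **THE `η`-WEIGHTED KERNEL `(∂P∂^*)_{μν}(x,x′)` OF (1.120)/(1.126) IN THE MODEL**:
`dpd n a N μ ν := DKRe μ · kerRe · (DKRe ν)ᵀ`, a real matrix on the fine torus `Π_μ Fin (nN_μ)` — the composition
`∂_μ(G′Q′^*) · (Q′G′²Q′^*)⁻¹ · (∂_ν(G′Q′^*))ᵀ` summed over the UNIT torus only.  It equals `η^{−(d+1)}` times the
counting-measure matrix of `∂_μ P ∂_ν^*`, `P = G′Q′*(Q′G′²Q′*)⁻¹Q′G′` (`Dmat_matrixP_Dmat_transpose`, §6), which is the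
normalisation of (1.120): «(∂P∂*hA)_μ(x) = Σ_{x′,ν} η^d(∂P∂*)_{μν}(x, x′)h(x′)A_ν(x′)» (printed dimension `d` = our `d+1`).
[cite: Balaban1984PropagatorsI, (1.120) p.37 and p.38 ll.7–10 (before (1.126))] -/
def dpd (n : ℕ) [NeZero n] (a : ℝ) (N : Fin (d + 1) → ℕ) (μ ν : Fin (d + 1)) :
    Matrix (Idx (fun i => n * N i)) (Idx (fun i => n * N i)) ℝ :=
  DKRe n a N μ * kerRe n a N * (DKRe n a N ν)ᵀ

/-! ### §4 Torus metric bookkeeping and the convolution estimate -/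

/-- the block label `⌊x/n⌋` of a fine torus site, as a site of the unit torus. [folklore] -/
def cIdx (n : ℕ) [NeZero n] (N : Fin (d + 1) → ℕ) (x : Idx (fun i => n * N i)) : Idx N :=
  fun i => ⟨(x i : ℕ) / n, (Nat.div_lt_iff_lt_mul (NeZero.pos n)).mpr (lt_of_lt_of_eq (x i).isLt (mul_comm _ _))⟩

/-- the representative of the block label is `coarse` of the representative. [folklore] -/
theorem toZ_cIdx (n : ℕ) [NeZero n] (N : Fin (d + 1) → ℕ) (x : Idx (fun i => n * N i)) :
    toZ (cIdx n N x) = coarse n (toZ x) := by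
  funext i
  simp only [B5QGGQ145Bounds.toZ, cIdx, coarse]
  exact Int.natCast_div _ _

/-- pv23's torus distance `tdist` on the unit torus IS b04's `torusSupNorm` of the difference of representatives. [folklore] -/
theorem tdist_eq_torusSupNorm {N : Fin (d + 1) → ℕ} (hN : ∀ i, 1 ≤ N i) (x y : Idx N) :
    tdist N x y = MultiPeriod.torusSupNorm N (toZ x - toZ y) := by
  have hc : ∀ i, ((ccoord N x y i : ℕ) : ℝ) = ((MultiPeriod.circAbs (N i) ((toZ x - toZ y) i) : ℤ) : ℝ) := by
    intro i
    show ((ccoord N x y i : ℕ) : ℝ) = ((MultiPeriod.circAbs (N i) (((x i : ℕ) : ℤ) - ((y i : ℕ) : ℤ)) : ℤ) : ℝ)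
    rw [← ccoord_cast hN x y i, Int.cast_natCast]
  apply le_antisymm
  · obtain ⟨i, -, hi⟩ := Finset.exists_mem_eq_sup (Finset.univ : Finset (Fin (d + 1))) Finset.univ_nonempty
      (ccoord N x y)
    unfold tdist
    rw [hi, hc i]
    exact Finset.le_sup' (fun j => ((MultiPeriod.circAbs (N j) ((B5QGGQ145Bounds.toZ x - B5QGGQ145Bounds.toZ y) j) : ℤ) : ℝ))
      (Finset.mem_univ i)
  · unfold MultiPeriod.torusSupNorm
    refine Finset.sup'_le _ _ fun i _ => ?_
    have h := circAbs_le_tdist hN x y i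
    simp only [B5QGGQ145Bounds.toZ, Pi.sub_apply]
    exact h

/-- **TORUS CONVOLUTION OF TWO EXPONENTIALLY DECAYING KERNELS, UNIFORMLY IN THE PERIOD**: if `|f(y)| ≤ A e^{−α t(x,y)}` and
`|g(y)| ≤ B e^{−α t(y,y′)}` on the discrete torus `Π_i ℤ/P_i` (`P_i ≥ 1`, sup-distance `t`), then
`|Σ_y f(y) g(y)| ≤ A·B·K_m(α/2)·e^{−(α/2) t(x,y′)}`, `K_m(b) = B4Sect5Proof.latticeConst m b = (2(1 − e^{−b/m})⁻¹)^m`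
(triangle inequality: `e^{−αt(x,y)}e^{−αt(y,y′)} ≤ e^{−(α/2)t(x,y′)}·e^{−(α/2)t(x,y)}`, then `torusSum_le`). [folklore] -/
theorem conv_decay {m : ℕ} {P : Fin m → ℕ} (hP : ∀ i, 1 ≤ P i) {α A B : ℝ} (hα : 0 < α)
    (f g : TSite m P → ℝ) (x y' : TSite m P)
    (hf : ∀ y, |f y| ≤ A * Real.exp (-(α * tdist P x y)))
    (hg : ∀ y, |g y| ≤ B * Real.exp (-(α * tdist P y y'))) :
    |∑ y, f y * g y| ≤ A * B * B4Sect5Proof.latticeConst m (α / 2) * Real.exp (-(α / 2 * tdist P x y')) := by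
  have hA : 0 ≤ A := by
    have h := (abs_nonneg _).trans (hf x)
    rwa [tdist_self, mul_zero, neg_zero, Real.exp_zero, mul_one] at h
  have hB : 0 ≤ B := by
    have h := (abs_nonneg _).trans (hg y')
    rwa [tdist_self, mul_zero, neg_zero, Real.exp_zero, mul_one] at h
  have hterm : ∀ y, |f y * g y| ≤
      A * B * Real.exp (-(α / 2 * tdist P x y')) * Real.exp (-(α / 2 * tdist P x y)) := by
    intro y
    rw [abs_mul]
    have h1 := hf y
    have h2 := hg y
    have hexp : Real.exp (-(α * tdist P x y)) * Real.exp (-(α * tdist P y y'))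
        ≤ Real.exp (-(α / 2 * tdist P x y')) * Real.exp (-(α / 2 * tdist P x y)) := by
      rw [← Real.exp_add, ← Real.exp_add]
      apply Real.exp_le_exp.mpr
      have ht := mul_le_mul_of_nonneg_left (tdist_triangle hP x y y') (half_pos hα).le
      have h0 := mul_nonneg hα.le (tdist_nonneg P y y')
      have h0' := mul_nonneg hα.le (tdist_nonneg P x y)
      nlinarith
    calc |f y| * |g y| ≤ (A * Real.exp (-(α * tdist P x y))) * (B * Real.exp (-(α * tdist P y y'))) :=
          mul_le_mul h1 h2 (abs_nonneg _) ((abs_nonneg _).trans h1)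
      _ = A * B * (Real.exp (-(α * tdist P x y)) * Real.exp (-(α * tdist P y y'))) := by ring
      _ ≤ A * B * (Real.exp (-(α / 2 * tdist P x y')) * Real.exp (-(α / 2 * tdist P x y))) :=
          mul_le_mul_of_nonneg_left hexp (mul_nonneg hA hB)
      _ = A * B * Real.exp (-(α / 2 * tdist P x y')) * Real.exp (-(α / 2 * tdist P x y)) := by ring
  have hK := torusSum_le m hP (half_pos hα) x
  have hc0 : 0 ≤ A * B * Real.exp (-(α / 2 * tdist P x y')) := by positivity
  calc |∑ y, f y * g y| ≤ ∑ y, |f y * g y| := Finset.abs_sum_le_sum_abs _ _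
    _ ≤ ∑ y, A * B * Real.exp (-(α / 2 * tdist P x y')) * Real.exp (-(α / 2 * tdist P x y)) :=
        Finset.sum_le_sum fun y _ => hterm y
    _ = A * B * Real.exp (-(α / 2 * tdist P x y')) * ∑ y, Real.exp (-(α / 2 * tdist P x y)) := by
        rw [Finset.mul_sum]
    _ ≤ A * B * Real.exp (-(α / 2 * tdist P x y')) * B4Sect5Proof.latticeConst m (α / 2) :=
        mul_le_mul_of_nonneg_left hK hc0
    _ = A * B * B4Sect5Proof.latticeConst m (α / 2) * Real.exp (-(α / 2 * tdist P x y')) := by ring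

/-- `periodConst κ d ≥ 0` for `κ > 0`. [folklore] -/
theorem periodConst_nonneg_of_pos {κ : ℝ} (hκ : 0 < κ) (d : ℕ) : 0 ≤ periodConst κ d := by
  unfold periodConst
  have h1 : Real.exp (-(κ / (d + 1))) < 1 := by
    have : (0 : ℝ) < κ / (d + 1) := by positivity
    exact Real.exp_lt_one_iff.mpr (by linarith)
  apply pow_nonneg
  apply div_nonneg (by positivity)
  linarith

/-! ### §5 (1.126), uniformly in `k` and in the volume -/

/-- **B5 (1.126) IN THE `U = 1` TORUS MULTIPLIER MODEL — «THE CONSTANT O(1) IN (1.126) DEPENDS ON d ONLY».**  For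
`0 < a₋ ≤ a₊` there are `δ > 0` and `C ≥ 0`, depending on `d, a₋, a₊` ONLY, such that for EVERY `n = L^k ≥ 1` (`NeZero`),
every `a ∈ [a₋, a₊]`, every period vector `N` (`N_μ ≥ 1`), all directions `μ, ν` and all fine torus sites `x, x′`:
  `|(∂P∂^*)_{μν}(x, x′)| = |dpd n a N μ ν x x′| ≤ C · e^{−δ·|⌊x/n⌋ − ⌊x′/n⌋|_{T₁}}`,
`|·|_{T₁} = MultiPeriod.torusSupNorm N` the sup-distance of the unit torus between the blocks of `x` and `x′` (the printed
`|x − x′|` up to the additive constant `1` and the factor `√(d+1)` between sup- and Euclidean metrics, absorbed in `C`, `δ`;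
see `dpd_decay_uniform_fine` for the fine-distance form).  Inputs: `DKRe_decay` (B4 Lemma 2.4 on the torus, differentiated),
`kerRe_decay` ((1.45) inverse), `conv_decay` twice.  [cite: Balaban1984PropagatorsI, (1.126) p.38 with p.38 l.20 «The
constant O(1) in (1.126) depends on d only»; proof supplied by the audit (composition over the unit torus), the printed
route being "Lemma 2.4 of [2], the representation (1.45) and the analyticity method"] -/
theorem dpd_decay_uniform (d : ℕ) (aminus aplus : ℝ) (ha : 0 < aminus) :
    ∃ δ C : ℝ, 0 < δ ∧ 0 ≤ C ∧ ∀ (n : ℕ) [NeZero n] (a : ℝ), aminus ≤ a → a ≤ aplus →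
      ∀ (N : Fin (d + 1) → ℕ), (∀ i, 1 ≤ N i) → ∀ (μ ν : Fin (d + 1)) (x x' : Idx (fun i => n * N i)),
        |dpd n a N μ ν x x'| ≤
          C * Real.exp (-(δ * MultiPeriod.torusSupNorm N (coarse n (toZ x) - coarse n (toZ x')))) := by
  obtain ⟨κ₁, M₁, hκ₁, hM₁, h₁⟩ := DKRe_decay d aminus aplus ha
  obtain ⟨κ₂, M₂, hκ₂, hM₂, h₂⟩ := kerRe_decay d aminus aplus ha
  have hd1 : (0 : ℝ) < (d : ℝ) + 1 := by positivity
  set α : ℝ := min κ₁ κ₂ / ((d : ℝ) + 1) with hα_def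
  have hα : 0 < α := div_pos (lt_min hκ₁ hκ₂) hd1
  have hα₁ : α ≤ κ₁ / ((d : ℝ) + 1) := div_le_div_of_nonneg_right (min_le_left _ _) hd1.le
  have hα₂ : α ≤ κ₂ / ((d : ℝ) + 1) := div_le_div_of_nonneg_right (min_le_right _ _) hd1.le
  set A : ℝ := M₁ * periodConst κ₁ d with hA_def
  set B : ℝ := M₂ * periodConst κ₂ d with hB_def
  have hA : 0 ≤ A := mul_nonneg hM₁ (periodConst_nonneg_of_pos hκ₁ d)
  have hB : 0 ≤ B := mul_nonneg hM₂ (periodConst_nonneg_of_pos hκ₂ d)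
  have hK2 : 0 ≤ B4Sect5Proof.latticeConst (d + 1) (α / 2) := B4Sect5Proof.latticeConst_nonneg (d + 1) (by positivity)
  have hK4 : 0 ≤ B4Sect5Proof.latticeConst (d + 1) (α / 2 / 2) :=
    B4Sect5Proof.latticeConst_nonneg (d + 1) (by positivity)
  refine ⟨α / 2 / 2, A * B * B4Sect5Proof.latticeConst (d + 1) (α / 2) * A *
    B4Sect5Proof.latticeConst (d + 1) (α / 2 / 2), by positivity, by positivity, ?_⟩
  intro n _ a ha1 ha2 N hN μ ν x x'
  -- the factor bounds, in pv23's torus distance on the unit torus, at the common rate `α`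
  have hDK : ∀ (ρ : Fin (d + 1)) (z : Idx (fun i => n * N i)) (k : Idx N),
      |DKRe n a N ρ z k| ≤ A * Real.exp (-(α * tdist N (cIdx n N z) k)) := by
    intro ρ z k
    refine (h₁ n a ha1 ha2 N hN ρ z k).trans ?_
    rw [tdist_eq_torusSupNorm hN, toZ_cIdx]
    apply mul_le_mul_of_nonneg_left _ hA
    apply Real.exp_le_exp.mpr
    have hT := MultiPeriod.torusSupNorm_nonneg hN (coarse n (toZ z) - toZ k)
    nlinarith
  have hker : ∀ k k' : Idx N, |kerRe n a N k k'| ≤ B * Real.exp (-(α * tdist N k k')) := by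
    intro k k'
    refine (h₂ n a ha1 ha2 N hN k k').trans ?_
    rw [tdist_eq_torusSupNorm hN]
    apply mul_le_mul_of_nonneg_left _ hB
    apply Real.exp_le_exp.mpr
    have hT := MultiPeriod.torusSupNorm_nonneg hN (toZ k - toZ k')
    nlinarith
  -- first composition: `∂_μ(G′Q′^*) · (Q′G′²Q′^*)⁻¹`
  have hconv1 : ∀ y' : Idx N, |(DKRe n a N μ * kerRe n a N) x y'| ≤
      A * B * B4Sect5Proof.latticeConst (d + 1) (α / 2) * Real.exp (-(α / 2 * tdist N (cIdx n N x) y')) := by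
    intro y'
    rw [Matrix.mul_apply]
    exact conv_decay hN hα _ _ (cIdx n N x) y' (fun y => hDK μ x y) (fun y => hker y y')
  -- second composition: `· (∂_ν(G′Q′^*))ᵀ`
  have hconv2 : |dpd n a N μ ν x x'| ≤
      A * B * B4Sect5Proof.latticeConst (d + 1) (α / 2) * A * B4Sect5Proof.latticeConst (d + 1) (α / 2 / 2) *
        Real.exp (-(α / 2 / 2 * tdist N (cIdx n N x) (cIdx n N x'))) := by
    unfold dpd
    rw [Matrix.mul_apply]
    refine conv_decay hN (half_pos hα) _ _ (cIdx n N x) (cIdx n N x') hconv1 ?_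
    intro y'
    rw [Matrix.transpose_apply, tdist_symm hN]
    refine (hDK ν x' y').trans ?_
    apply mul_le_mul_of_nonneg_left _ hA
    apply Real.exp_le_exp.mpr
    have ht := mul_nonneg hα.le (tdist_nonneg N (cIdx n N x') y')
    nlinarith
  rw [tdist_eq_torusSupNorm hN, toZ_cIdx, toZ_cIdx] at hconv2
  exact hconv2

/-! ### §5′ The printed form: fine-torus distance `|x − x′| = η · tdist_{T_η}(x,x′)` -/

/-- `dist(n·m, nNℤ) = n·dist(m, Nℤ)`. [folklore] -/
theorem circAbs_mul_left (n : ℕ) (hn : 0 < n) (N : ℕ) (m : ℤ) :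
    MultiPeriod.circAbs (n * N) ((n : ℤ) * m) = n * MultiPeriod.circAbs N m := by
  have hc' : (0 : ℤ) < n := by exact_mod_cast hn
  unfold MultiPeriod.circAbs
  rw [Nat.cast_mul, Int.mul_emod_mul_of_pos _ _ hc', ← mul_sub]
  rcases le_total (m % (N : ℤ)) ((N : ℤ) - m % (N : ℤ)) with h | h
  · rw [min_eq_left h, min_eq_left (mul_le_mul_of_nonneg_left h hc'.le)]
  · rw [min_eq_right h, min_eq_right (mul_le_mul_of_nonneg_left h hc'.le)]

/-- **FINE VERSUS COARSE TORUS DISTANCE**: on `Π_μ ℤ/(nN_μ)`, `tdist(x,x′) ≤ n·|⌊x/n⌋ − ⌊x′/n⌋|_{T₁} + (n − 1)`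
(per coordinate `x_μ − x′_μ = n(⌊x_μ/n⌋ − ⌊x′_μ/n⌋) + (r − r′)`, `|r − r′| ≤ n − 1`, subadditivity of the circular distance
and `dist(n·m, nNℤ) = n·dist(m, Nℤ)`). [folklore] -/
theorem tdist_fine_le (n : ℕ) [NeZero n] {N : Fin (d + 1) → ℕ} (hN : ∀ i, 1 ≤ N i) (x x' : Idx (fun i => n * N i)) :
    tdist (fun i => n * N i) x x'
      ≤ n * MultiPeriod.torusSupNorm N (coarse n (toZ x) - coarse n (toZ x')) + ((n : ℝ) - 1) := by
  have hn : 0 < n := NeZero.pos n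
  have hn1 : 1 ≤ n := hn
  have hnN : ∀ i, 1 ≤ n * N i := fun i => Nat.one_le_iff_ne_zero.mpr (Nat.mul_ne_zero (NeZero.ne n)
    (Nat.one_le_iff_ne_zero.mp (hN i)))
  have hT := MultiPeriod.torusSupNorm_nonneg hN (coarse n (toZ x) - coarse n (toZ x'))
  -- coordinatewise
  have hco : ∀ i, ((ccoord (fun i => n * N i) x x' i : ℕ) : ℝ)
      ≤ n * MultiPeriod.torusSupNorm N (coarse n (toZ x) - coarse n (toZ x')) + ((n : ℝ) - 1) := by
    intro i
    have hcast := ccoord_cast hnN x x' i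
    set cx : ℤ := ((x i : ℕ) : ℤ) / n with hcx
    set cx' : ℤ := ((x' i : ℕ) : ℤ) / n with hcx'
    set r : ℤ := ((x i : ℕ) : ℤ) % n with hr
    set r' : ℤ := ((x' i : ℕ) : ℤ) % n with hr'
    have hnz : (0 : ℤ) < n := by exact_mod_cast hn
    have hdec : ((x i).val : ℤ) - ((x' i).val : ℤ) = (n : ℤ) * (cx - cx') + (r - r') := by
      have e1 := Int.mul_ediv_add_emod (((x i : ℕ) : ℤ)) (n : ℤ)
      have e2 := Int.mul_ediv_add_emod (((x' i : ℕ) : ℤ)) (n : ℤ)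
      simp only [hcx, hcx', hr, hr'] at e1 e2 ⊢
      linarith
    have hr0 : 0 ≤ r := Int.emod_nonneg _ hnz.ne'
    have hr1 : r < n := Int.emod_lt_of_pos _ hnz
    have hr0' : 0 ≤ r' := Int.emod_nonneg _ hnz.ne'
    have hr1' : r' < n := Int.emod_lt_of_pos _ hnz
    have hrr : |r - r'| ≤ (n : ℤ) - 1 := by rw [abs_le]; constructor <;> omega
    have hcirc : MultiPeriod.circAbs (n * N i) (((x i).val : ℤ) - ((x' i).val : ℤ))
        ≤ n * MultiPeriod.circAbs (N i) (cx - cx') + ((n : ℤ) - 1) := by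
      rw [hdec]
      refine (circAbs_add_le (hnN i) _ _).trans ?_
      rw [circAbs_mul_left n hn (N i)]
      exact add_le_add le_rfl ((MultiPeriod.circAbs_le_abs (hnN i) _).trans hrr)
    have hsup : ((MultiPeriod.circAbs (N i) (cx - cx') : ℤ) : ℝ)
        ≤ MultiPeriod.torusSupNorm N (coarse n (toZ x) - coarse n (toZ x')) := by
      have : cx - cx' = (coarse n (toZ x) - coarse n (toZ x')) i := by
        rw [hcx, hcx']
        rfl
      rw [this]
      exact Finset.le_sup' (fun j => ((MultiPeriod.circAbs (N j)
        ((coarse n (B5QGGQ145Bounds.toZ x) - coarse n (B5QGGQ145Bounds.toZ x')) j) : ℤ) : ℝ)) (Finset.mem_univ i)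
    have h3 : ((ccoord (fun i => n * N i) x x' i : ℕ) : ℝ)
        = ((MultiPeriod.circAbs (n * N i) (((x i).val : ℤ) - ((x' i).val : ℤ)) : ℤ) : ℝ) := by
      exact_mod_cast hcast
    rw [h3]
    have h4 : ((MultiPeriod.circAbs (n * N i) (((x i).val : ℤ) - ((x' i).val : ℤ)) : ℤ) : ℝ)
        ≤ ((n * MultiPeriod.circAbs (N i) (cx - cx') + ((n : ℤ) - 1) : ℤ) : ℝ) := by exact_mod_cast hcirc
    refine h4.trans ?_
    push_cast
    nlinarith [hsup, (Nat.cast_nonneg n : (0 : ℝ) ≤ n)]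
  obtain ⟨i, -, hi⟩ := Finset.exists_mem_eq_sup (Finset.univ : Finset (Fin (d + 1))) Finset.univ_nonempty
    (ccoord (fun i => n * N i) x x')
  unfold tdist
  rw [hi]
  exact hco i

/-- **(1.126) IN THE PRINTED FORM.**  Same constants' dependence (`d, a₋, a₊` only): for every `n = L^k ≥ 1`, `a ∈ [a₋,a₊]`,
`N`, `μ, ν` and fine torus sites `x, x′`, `|dpd n a N μ ν x x′| ≤ C · e^{−(δ/n)·tdist_{T_η}(x,x′)}` — and
`(1/n)·tdist_{T_η}(x,x′) = η·(sup number of fine steps) = |x − x′|` in the units of the paper (lattice spacing `η = L^{−k}`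
on `T_η`, sup-metric).  [cite: Balaban1984PropagatorsI, (1.126) p.38 with p.38 l.20; proof supplied by the audit] -/
theorem dpd_decay_uniform_fine (d : ℕ) (aminus aplus : ℝ) (ha : 0 < aminus) :
    ∃ δ C : ℝ, 0 < δ ∧ 0 ≤ C ∧ ∀ (n : ℕ) [NeZero n] (a : ℝ), aminus ≤ a → a ≤ aplus →
      ∀ (N : Fin (d + 1) → ℕ), (∀ i, 1 ≤ N i) → ∀ (μ ν : Fin (d + 1)) (x x' : Idx (fun i => n * N i)),
        |dpd n a N μ ν x x'| ≤ C * Real.exp (-(δ / n * tdist (fun i => n * N i) x x')) := by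
  obtain ⟨δ, C, hδ, hC, h⟩ := dpd_decay_uniform d aminus aplus ha
  refine ⟨δ, C * Real.exp δ, hδ, by positivity, fun n _ a ha1 ha2 N hN μ ν x x' => ?_⟩
  refine (h n a ha1 ha2 N hN μ ν x x').trans ?_
  rw [mul_assoc, ← Real.exp_add]
  apply mul_le_mul_of_nonneg_left _ hC
  apply Real.exp_le_exp.mpr
  have hn : (0 : ℝ) < n := by exact_mod_cast NeZero.pos n
  have ht := tdist_fine_le n hN x x'
  have hT := MultiPeriod.torusSupNorm_nonneg hN (coarse n (toZ x) - coarse n (toZ x'))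
  have htd := tdist_nonneg (fun i => n * N i) x x'
  -- `δ/n · tdist ≤ δ·T + δ·(n-1)/n ≤ δ·T + δ`
  have h1 : δ / n * tdist (fun i => n * N i) x x'
      ≤ δ * MultiPeriod.torusSupNorm N (coarse n (toZ x) - coarse n (toZ x')) + δ := by
    rw [div_mul_eq_mul_div, div_le_iff₀ hn]
    have := mul_le_mul_of_nonneg_left ht hδ.le
    nlinarith
  linarith

/-! ### §6 Dictionary: `dpd` is `η^{−(d+1)}` times the counting-measure matrix of `∂_μ P ∂_ν^*` -/

/-- the forward neighbour `z + e_μ` on the discrete torus `Π_i ℤ/P_i` (wrap-around in the coordinate `μ`). [folklore] -/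
def fup {P : Fin (d + 1) → ℕ} (μ : Fin (d + 1)) (z : Idx P) : Idx P :=
  Function.update z μ ⟨((z μ : ℕ) + 1) % P μ, Nat.mod_lt _ (Fin.pos (z μ))⟩

/-- the representative of the forward neighbour is a period-translate of `toZ z + e_μ`. [folklore] -/
theorem toZ_fup {P : Fin (d + 1) → ℕ} (μ : Fin (d + 1)) (z : Idx P) :
    toZ (fup μ z) = MultiPeriod.translate P (toZ z + e μ) (fun i => -((toZ z + e μ) i / (P i : ℤ))) := by
  funext i
  rw [MultiPeriod.translate_apply]
  simp only [B5QGGQ145Bounds.toZ, Pi.add_apply, e]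
  by_cases hi : i = μ
  · subst hi
    simp only [fup, Function.update_self, Fin.val_mk, Pi.single_eq_same]
    push_cast
    rw [Int.emod_def]
    ring
  · simp only [fup, Function.update_of_ne hi, Pi.single_eq_of_ne hi, add_zero]
    rw [Int.ediv_eq_zero_of_lt (by positivity) (by exact_mod_cast (z i).isLt)]
    ring

/-- **`DKRe μ` IS THE FORWARD `η⁻¹`-DIFFERENCE OF `KRe` ALONG THE FINE TORUS**: `DKRe μ (z,k) = n·(KRe(z + e_μ, k) − KRe(z, k))`
with the torus neighbour `fup μ z` (periodicity `KT_translate_left`). [cite: Balaban1983RegularityDecay, p.573 (difference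
derivative `(∂^η_μA)(x) = η^{−1}(A(x+ηe_μ) − A(x))`)] -/
theorem DKRe_eq_fdiff (n : ℕ) [NeZero n] (a : ℝ) {N : Fin (d + 1) → ℕ} (hN : ∀ i, 1 ≤ N i) (μ : Fin (d + 1))
    (z : Idx (fun i => n * N i)) (k : Idx N) :
    DKRe n a N μ z k = n * (KRe n a N (fup μ z) k - KRe n a N z k) := by
  simp only [DKRe, KRe, Matrix.of_apply]
  rw [toZ_fup μ z, KT_translate_left n a 0 hN]

/-- **THE MATRIX OF `∂_μ = η⁻¹`(FORWARD DIFFERENCE) ON THE FINE TORUS** `Π_i ℤ/P_i` (`η = 1/n`):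
`(Dmat f)(x) = n·(f(x + e_μ) − f(x))` (`Dmat_mul`). [cite: Balaban1983RegularityDecay, p.573] -/
def Dmat (n : ℕ) (P : Fin (d + 1) → ℕ) (μ : Fin (d + 1)) : Matrix (Idx P) (Idx P) ℝ :=
  Matrix.of fun x x'' => (n : ℝ) * ((if x'' = fup μ x then 1 else 0) - (if x'' = x then 1 else 0))

/-- left multiplication by `Dmat μ` is the forward difference quotient in the row index. [folklore] -/
theorem Dmat_mul {ι : Type*} (n : ℕ) (P : Fin (d + 1) → ℕ) (μ : Fin (d + 1)) (M : Matrix (Idx P) ι ℝ)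
    (x : Idx P) (j : ι) : (Dmat n P μ * M) x j = n * (M (fup μ x) j - M x j) := by
  have h : ∀ x'' : Idx P, (n : ℝ) * ((if x'' = fup μ x then 1 else 0) - (if x'' = x then 1 else 0)) * M x'' j
      = (n : ℝ) * ((if x'' = fup μ x then M x'' j else 0) - (if x'' = x then M x'' j else 0)) := by
    intro x''
    split_ifs <;> ring
  simp only [Matrix.mul_apply, Dmat, Matrix.of_apply, h]
  rw [← Finset.mul_sum, Finset.sum_sub_distrib, Finset.sum_ite_eq' Finset.univ (fup μ x),
    Finset.sum_ite_eq' Finset.univ x]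
  simp only [Finset.mem_univ, if_true]

/-- right multiplication by `(Dmat ν)ᵀ` is the forward difference quotient in the column index (`∂_ν^*` = transpose for the
common weight `η^{d+1}` on scalar and vector fields on `T_η`). [folklore] -/
theorem mul_Dmat_transpose {ι : Type*} (n : ℕ) (P : Fin (d + 1) → ℕ) (ν : Fin (d + 1)) (M : Matrix ι (Idx P) ℝ)
    (j : ι) (x : Idx P) : (M * (Dmat n P ν)ᵀ) j x = n * (M j (fup ν x) - M j x) := by
  rw [← Matrix.transpose_apply (M * (Dmat n P ν)ᵀ) x j, Matrix.transpose_mul, Matrix.transpose_transpose, Dmat_mul]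
  simp only [Matrix.transpose_apply]

/-- `∂_μ(G′Q′^*)` as a matrix product: `Dmat μ · KRe = DKRe μ`. [folklore] -/
theorem Dmat_mul_KRe (n : ℕ) [NeZero n] (a : ℝ) {N : Fin (d + 1) → ℕ} (hN : ∀ i, 1 ≤ N i) (μ : Fin (d + 1)) :
    Dmat n (fun i => n * N i) μ * KRe n a N = DKRe n a N μ := by
  ext z k
  rw [Dmat_mul, DKRe_eq_fdiff n a hN]

/-- **`dpd` IS THE `η`-WEIGHTED KERNEL OF `∂P∂^*`**: with `KRe·kerRe·QGRe` the counting-measure matrix of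
`P = G′Q′*(Q′G′²Q′*)⁻¹Q′G′` on the fine torus (b05-g7's dictionary: `KRe` = `G′Q′^*`, `kerRe = (Q′G′²Q′^*)⁻¹`,
`QGRe = η^{d+1}KReᵀ` = `Q′G′`), the counting-measure matrix of `∂_μ P ∂_ν^*` is
`Dmat μ · (KRe·kerRe·QGRe) · (Dmat ν)ᵀ = η^{d+1} · dpd μ ν`; by (1.120) the `η`-weighted kernel is `η^{−(d+1)}` times the
counting-measure matrix, i.e. `dpd`. [cite: Balaban1984PropagatorsI, (1.120) p.37, p.38 ll.7–10 (before (1.126))] -/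
theorem Dmat_matrixP_Dmat_transpose (n : ℕ) [NeZero n] (a : ℝ) {N : Fin (d + 1) → ℕ} (hN : ∀ i, 1 ≤ N i)
    (μ ν : Fin (d + 1)) :
    Dmat n (fun i => n * N i) μ * (KRe n a N * kerRe n a N * QGRe n a N) * (Dmat n (fun i => n * N i) ν)ᵀ
      = ((n : ℝ) ^ (d + 1))⁻¹ • dpd n a N μ ν := by
  unfold dpd QGRe
  rw [← Dmat_mul_KRe n a hN μ, ← Dmat_mul_KRe n a hN ν, Matrix.transpose_mul, Matrix.mul_smul, Matrix.mul_smul,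
    Matrix.smul_mul]
  simp only [Matrix.mul_assoc]

/-- **(1.126) FOR THE COUNTING-MEASURE MATRIX OF `∂_μ P ∂_ν^*`** (the form a finite-dimensional computation sees):
`|(Dmat μ · (KRe·kerRe·QGRe) · (Dmat ν)ᵀ)(x,x′)| ≤ η^{d+1} · C · e^{−δ·|⌊x/n⌋ − ⌊x′/n⌋|_{T₁}}`, constants `d, a₋, a₊` only.
[cite: Balaban1984PropagatorsI, (1.126) p.38 with (1.120) p.37; proof supplied by the audit] -/
theorem matrixP_decay_uniform (d : ℕ) (aminus aplus : ℝ) (ha : 0 < aminus) :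
    ∃ δ C : ℝ, 0 < δ ∧ 0 ≤ C ∧ ∀ (n : ℕ) [NeZero n] (a : ℝ), aminus ≤ a → a ≤ aplus →
      ∀ (N : Fin (d + 1) → ℕ), (∀ i, 1 ≤ N i) → ∀ (μ ν : Fin (d + 1)) (x x' : Idx (fun i => n * N i)),
        |(Dmat n (fun i => n * N i) μ * (KRe n a N * kerRe n a N * QGRe n a N) *
            (Dmat n (fun i => n * N i) ν)ᵀ) x x'|
          ≤ ((n : ℝ) ^ (d + 1))⁻¹ * C *
            Real.exp (-(δ * MultiPeriod.torusSupNorm N (coarse n (toZ x) - coarse n (toZ x')))) := by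
  obtain ⟨δ, C, hδ, hC, h⟩ := dpd_decay_uniform d aminus aplus ha
  refine ⟨δ, C, hδ, hC, fun n _ a ha1 ha2 N hN μ ν x x' => ?_⟩
  rw [Dmat_matrixP_Dmat_transpose n a hN, Matrix.smul_apply, smul_eq_mul, abs_mul,
    abs_of_nonneg (by positivity : (0 : ℝ) ≤ ((n : ℝ) ^ (d + 1))⁻¹), mul_assoc]
  exact mul_le_mul_of_nonneg_left (h n a ha1 ha2 N hN μ ν x x') (by positivity)

end

end Literature.MathematicalPhysics.QuantumFieldTheory.Balaban1983to89.B5DPD126Uniform
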